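import Summits.CriticalPhenomena.PercolationContinuityZ3.Theorems.PercNearOneGluingNoHeavyLowerTailMajorityGluingEightCertLaw
import HarnessLib

/-!
# The percolation dictionary of the certificate language for ANY number `k` of relays (lane prim-rate, constants-miner 1, gen 34; CANDIDATES §GEN-34 R325, NEXT-g35 item 2)

Support file for the closed crux `NoHeavyLowerTail` (stmt-CriticalPhenomena-4575), majority-gluing line.  `…MajorityGluingEightCertLaw` wrote the dictionary between the certificate
language `…MajorityGluingQCert` and bond percolation for SIX relays; this file is the same dictionary for an enumeration `t : Fin k → Fin n` of `k` relays and an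
arbitrary threshold `c.h` (so that certificates for the cells `(7,5)`, `R_5 = (8,5)`, … land with data only): the cut code `encK ω < 2^k`, the point `lawvK`
(`K ↦ μ(encK = K)`, `2^k ↦ δ`), `linv_lawvK` (every `0/1`-form vanishing at `2^k` = the probability of its event), the events `setOf_margMemK`, `setOf_tMemK`
(`c.h ≤ #cut T`), `setOf_eMemK` (family `1`), `setOf_cylK` (masks = cylinder events, `X < 2^k`), and `imK_or/and/zero`.  Proofs are those of the six-relay file with
`6 ↦ k`; the generic lemmas `code`, `testBit_code`, `cylMem_iff`, `popc_eq_card` are imported from it.  No sorries. [folklore]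
-/

noncomputable section

namespace Summit.CriticalPhenomena.PercolationContinuityZ3.Theorems

open MeasureTheory Set
open Literature.Probability.LatticeModels (prodBernoulli)
open Literature.Probability.Percolation
open scoped Classical

namespace HubOnly
namespace QCert

/-! ### The cut code of a configuration -/

variable {n k : ℕ}

/-- The cut vector of `ω` along the enumeration `t` (extended by `false`). -/
def cutFnK (a₀ : Fin n) (t : Fin k → Fin n) (ω : BondConfig (Fin n)) (i : ℕ) : Bool :=
  if h : i < k then decide (ω ∉ (openConn a₀ (t ⟨i, h⟩) : Set (BondConfig (Fin n)))) else false

/-- The cut code: bit `x` = «`t x` is cut from `a₀`». -/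
def encK (a₀ : Fin n) (t : Fin k → Fin n) (ω : BondConfig (Fin n)) : ℕ := code k (cutFnK a₀ t ω)

/-- The cut code is `< 2^k`. -/
theorem encK_lt (a₀ : Fin n) (t : Fin k → Fin n) (ω : BondConfig (Fin n)) : encK a₀ t ω < 2 ^ k := code_lt k _

/-- Bit `x` of the cut code is «`t x` is cut from `a₀`». -/
theorem testBit_encK (a₀ : Fin n) (t : Fin k → Fin n) (ω : BondConfig (Fin n)) (x : Fin k) :
    (encK a₀ t ω).testBit x = decide (ω ∉ (openConn a₀ (t x) : Set (BondConfig (Fin n)))) := by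
  rw [encK, testBit_code]; simp [cutFnK, x.isLt]

/-- Bit `i < k` of the cut code is «`t i` is cut from `a₀`». -/
theorem testBit_encK_of_lt (a₀ : Fin n) (t : Fin k → Fin n) (ω : BondConfig (Fin n)) (i : ℕ) (hi : i < k) :
    (encK a₀ t ω).testBit i = decide (ω ∉ (openConn a₀ (t ⟨i, hi⟩) : Set (BondConfig (Fin n)))) :=
  testBit_encK a₀ t ω ⟨i, hi⟩

/-- The cut code has no bits `≥ k`. -/
theorem testBit_encK_of_ge (a₀ : Fin n) (t : Fin k → Fin n) (ω : BondConfig (Fin n)) (i : ℕ) (hi : k ≤ i) :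
    (encK a₀ t ω).testBit i = false := by
  rw [encK, testBit_code]; simp; omega

/-- **Partition by the cut code:** `μ{P(encK ω)} = Σ_{K<2^k} [P K]·μ(encK = K)`. [folklore] -/
theorem real_setOf_encK (w : Sym2 (Fin n) → unitInterval) (a₀ : Fin n) (t : Fin k → Fin n) (P : ℕ → Bool) :
    (prodBernoulli w).real {ω : BondConfig (Fin n) | P (encK a₀ t ω) = true} =
      ∑ K ∈ Finset.range (2 ^ k), if P K then (prodBernoulli w).real {ω : BondConfig (Fin n) | encK a₀ t ω = K} else 0 := by
  have hms : ∀ S' : Set (BondConfig (Fin n)), MeasurableSet S' := fun _ => MeasurableSet.of_discrete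
  set S : Set (BondConfig (Fin n)) := {ω | P (encK a₀ t ω) = true} with hS
  have h := sum_measureReal_preimage_singleton (μ := (prodBernoulli w).restrict S) (Finset.range (2 ^ k)) (f := encK a₀ t)
    (fun K _ => hms _)
  have hpre : (encK a₀ t) ⁻¹' (↑(Finset.range (2 ^ k)) : Set ℕ) = univ :=
    eq_univ_of_forall fun ω => by rw [mem_preimage, Finset.mem_coe, Finset.mem_range]; exact encK_lt a₀ t ω
  rw [hpre, measureReal_restrict_apply_univ] at h
  rw [← h]
  refine Finset.sum_congr rfl fun K _ => ?_
  rw [measureReal_restrict_apply (hms _)]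
  by_cases hP : P K = true
  · rw [if_pos hP]; congr 1; ext ω
    simp only [mem_inter_iff, mem_preimage, mem_singleton_iff, hS, mem_setOf_eq]
    exact ⟨fun h => h.1, fun h => ⟨h, by rw [h]; exact hP⟩⟩
  · rw [if_neg hP]
    have : (encK a₀ t) ⁻¹' {K} ∩ S = ∅ := by
      ext ω; simp only [mem_inter_iff, mem_preimage, mem_singleton_iff, hS, mem_setOf_eq, mem_empty_iff_false, iff_false, not_and]
      intro h; rw [h]; exact hP
    rw [this, measureReal_empty]

/-- The point of the certificate language: `K ↦ μ(encK = K)` for `K < 2^k`, `2^k ↦ δ`, `0` beyond. -/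
def lawvK (w : Sym2 (Fin n) → unitInterval) (a₀ : Fin n) (t : Fin k → Fin n) (δ : ℝ) (K : ℕ) : ℝ :=
  if K < 2 ^ k then (prodBernoulli w).real {ω : BondConfig (Fin n) | encK a₀ t ω = K} else if K = 2 ^ k then δ else 0

/-- The point `lawvK` is nonnegative (for `δ ≥ 0`). -/
theorem lawvK_nonneg (w : Sym2 (Fin n) → unitInterval) (a₀ : Fin n) (t : Fin k → Fin n) (δ : ℝ) (hδ : 0 ≤ δ) (K : ℕ) :
    0 ≤ lawvK w a₀ t δ K := by
  unfold lawvK; split_ifs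
  · exact measureReal_nonneg
  · exact hδ
  · exact le_rfl

/-- The variable `2^k` of `lawvK` is `δ`. -/
theorem lawvK_D (w : Sym2 (Fin n) → unitInterval) (a₀ : Fin n) (t : Fin k → Fin n) (δ : ℝ) : lawvK w a₀ t δ (2 ^ k) = δ := by
  simp [lawvK]

/-- **Every `0/1`-form of the language is the probability of its event** (forms vanishing at the variable `2^k = δ`). [folklore] -/
theorem linv_lawvK (w : Sym2 (Fin n) → unitInterval) (a₀ : Fin n) (t : Fin k → Fin n) (δ : ℝ) (P : ℕ → Bool) (hP : P (2 ^ k) = false) :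
    linv (2 ^ k + 1) (fun i => Cert.bi (P i)) (lawvK w a₀ t δ) = (prodBernoulli w).real {ω : BondConfig (Fin n) | P (encK a₀ t ω) = true} := by
  rw [real_setOf_encK, linv, Finset.sum_range_succ, hP]
  simp only [Cert.bi, Bool.false_eq_true, ↓reduceIte, Int.cast_zero, zero_mul, add_zero]
  refine Finset.sum_congr rfl fun K hK => ?_
  rw [Finset.mem_range] at hK
  unfold lawvK; rw [if_pos hK]
  cases P K <;> simp

/-! ### The events of the language -/

/-- The number of cut relays is the popcount of the code (for an injective enumeration of `T`). [folklore] -/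
theorem popc_encK (a₀ : Fin n) (t : Fin k → Fin n) (ht : Function.Injective t) (T : Finset (Fin n))
    (hT : T = Finset.univ.image t) (ω : BondConfig (Fin n)) :
    popc k (encK a₀ t ω) = (T.filter fun x => ω ∉ (openConn a₀ x : Set (BondConfig (Fin n)))).card := by
  rw [popc_eq_card, hT, Finset.filter_image, Finset.card_image_of_injective _ ht]
  -- both sides count `{i < k | t i cut}`
  rw [← Nat.Iio_eq_range, ← Fin.map_valEmbedding_univ, Finset.filter_map, Finset.card_map]
  congr 1
  ext x
  simp only [Finset.mem_filter, Finset.mem_univ, true_and, Function.comp_apply, Fin.valEmbedding_apply, testBit_encK,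
    decide_eq_true_eq]

/-- The image of a bitmask of relay indices. -/
def imK (t : Fin k → Fin n) (A : ℕ) : Set (Fin n) := {v | ∃ x : Fin k, A.testBit x = true ∧ t x = v}

/-- The image of a union of bitmasks. -/
theorem imK_or (t : Fin k → Fin n) (A B : ℕ) : imK t (A ||| B) = imK t A ∪ imK t B := by
  ext v
  simp only [imK, mem_setOf_eq, mem_union, Nat.testBit_lor, Bool.or_eq_true]
  constructor
  · rintro ⟨x, h | h, rfl⟩
    · exact Or.inl ⟨x, h, rfl⟩
    · exact Or.inr ⟨x, h, rfl⟩
  · rintro (⟨x, h, rfl⟩ | ⟨x, h, rfl⟩)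
    · exact ⟨x, Or.inl h, rfl⟩
    · exact ⟨x, Or.inr h, rfl⟩

/-- The image of an intersection of bitmasks (injective enumeration). -/
theorem imK_and (t : Fin k → Fin n) (ht : Function.Injective t) (X Y : ℕ) : imK t (X &&& Y) = imK t X ∩ imK t Y := by
  ext v
  simp only [imK, mem_setOf_eq, mem_inter_iff, Nat.testBit_land, Bool.and_eq_true]
  constructor
  · rintro ⟨x, ⟨h1, h2⟩, rfl⟩; exact ⟨⟨x, h1, rfl⟩, ⟨x, h2, rfl⟩⟩
  · rintro ⟨⟨x, h1, rfl⟩, ⟨y, h2, hy⟩⟩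
    have hxy : y = x := ht hy
    subst hxy
    exact ⟨y, ⟨h1, h2⟩, rfl⟩

/-- The image of the empty bitmask. -/
theorem imK_zero (t : Fin k → Fin n) : imK t 0 = ∅ := by
  ext v; simp [imK]

section Dictionary

variable (c : Cert) (hm : c.m = k) (hfam : c.fam = 1)
include hm

/-- The marginal form of relay `x < k` is «`t x` cut». -/
theorem setOf_margMemK (a₀ : Fin n) (t : Fin k → Fin n) (x : Fin k) :
    {ω : BondConfig (Fin n) | c.margMem x (encK a₀ t ω) = true} = (openConn a₀ (t x) : Set (BondConfig (Fin n)))ᶜ := by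
  ext ω
  simp only [mem_setOf_eq, Cert.margMem, hm, Bool.and_eq_true, decide_eq_true_eq, tb_eq, testBit_encK, mem_compl_iff]
  exact ⟨fun h => h.2, fun h => ⟨encK_lt a₀ t ω, h⟩⟩

/-- The threshold form is «at least `h` of `T` cut». -/
theorem setOf_tMemK (a₀ : Fin n) (t : Fin k → Fin n) (ht : Function.Injective t) (T : Finset (Fin n))
    (hT : T = Finset.univ.image t) :
    {ω : BondConfig (Fin n) | c.tMem (encK a₀ t ω) = true} =
      {ω : BondConfig (Fin n) | c.h ≤ (T.filter fun x => ω ∉ (openConn a₀ x : Set (BondConfig (Fin n)))).card} := by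
  ext ω
  simp only [mem_setOf_eq, Cert.tMem, hm, Bool.and_eq_true, decide_eq_true_eq, popc_encK a₀ t ht T hT]
  exact ⟨fun h => h.2, fun h => ⟨encK_lt a₀ t ω, h⟩⟩

include hfam in
/-- The case form of relay `x < k` (family `1`) is «`t x` attached and at least `h` of `T` cut». -/
theorem setOf_eMemK (a₀ : Fin n) (t : Fin k → Fin n) (ht : Function.Injective t) (T : Finset (Fin n))
    (hT : T = Finset.univ.image t) (x : Fin k) :
    {ω : BondConfig (Fin n) | c.eMem x (encK a₀ t ω) = true} =
      (openConn a₀ (t x) : Set (BondConfig (Fin n))) ∩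
        {ω : BondConfig (Fin n) | c.h ≤ (T.filter fun x => ω ∉ (openConn a₀ x : Set (BondConfig (Fin n)))).card} := by
  ext ω
  have he : c.eMem x (encK a₀ t ω) = (decide (encK a₀ t ω < 2 ^ k) && decide (c.h ≤ popc k (encK a₀ t ω)) && !tb (encK a₀ t ω) x) := by
    unfold Cert.eMem; rw [hfam, hm]; rfl
  rw [mem_setOf_eq, mem_inter_iff, mem_setOf_eq, he, popc_encK a₀ t ht T hT, tb_eq, testBit_encK]
  simp only [Bool.and_eq_true, decide_eq_true_eq, Bool.not_eq_true', decide_eq_false_iff_not, not_not]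
  constructor
  · rintro ⟨⟨_, h4⟩, hatt⟩; exact ⟨hatt, h4⟩
  · rintro ⟨hatt, h4⟩; exact ⟨⟨encK_lt a₀ t ω, h4⟩, hatt⟩

/-- **A mask agreeing with the cylinder `(A, X)` evaluates to the cylinder event** «`imK A` attached, `imK X` cut». [folklore] -/
theorem setOf_cylK (a₀ : Fin n) (t : Fin k → Fin n) (A X mk : ℕ) (hX64 : X < 2 ^ k) (hmk : c.maskOK A X mk = true) :
    {ω : BondConfig (Fin n) | tb mk (encK a₀ t ω) = true} =
      {ω : BondConfig (Fin n) | ∀ a ∈ imK t A, ω ∈ (openConn a₀ a : Set (BondConfig (Fin n)))} ∩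
        {ω | ∀ x ∈ imK t X, ω ∉ (openConn a₀ x : Set (BondConfig (Fin n)))} := by
  unfold Cert.maskOK at hmk
  simp only [Bool.and_eq_true, List.all_eq_true, hm] at hmk
  obtain ⟨_, hall⟩ := hmk
  ext ω
  have hK := encK_lt a₀ t ω
  have hagree : tb mk (encK a₀ t ω) = cylMem k A X (encK a₀ t ω) := by
    have h := hall (encK a₀ t ω) (List.mem_range.2 hK)
    cases h1 : tb mk (encK a₀ t ω) <;> cases h2 : cylMem k A X (encK a₀ t ω) <;> simp_all
  rw [mem_setOf_eq, hagree, cylMem_iff k A X _ hK]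
  simp only [imK, mem_inter_iff, mem_setOf_eq, forall_exists_index, and_imp]
  constructor
  · rintro ⟨hX, hA⟩
    refine ⟨fun a x hx hxa => ?_, fun v x hx hxv => ?_⟩
    · subst hxa
      have h := hA x hx
      rw [testBit_encK] at h
      simpa using h
    · subst hxv
      have h := hX x hx
      rw [testBit_encK] at h
      simpa using h
  · rintro ⟨hatt, hcut⟩
    refine ⟨fun i hi => ?_, fun i hi => ?_⟩
    · by_cases h6 : i < k
      · rw [testBit_encK_of_lt a₀ t ω i h6, decide_eq_true_eq]
        exact hcut (t ⟨i, h6⟩) ⟨i, h6⟩ hi rfl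
      · -- `X < 2^k` has no bit `i ≥ k`
        exfalso
        have hX : X < 2 ^ i := lt_of_lt_of_le hX64 (Nat.pow_le_pow_right (by norm_num) (by omega))
        rw [Nat.testBit_lt_two_pow hX] at hi
        exact Bool.false_ne_true hi
    · by_cases h6 : i < k
      · rw [testBit_encK_of_lt a₀ t ω i h6]
        have := hatt (t ⟨i, h6⟩) ⟨i, h6⟩ hi rfl
        simpa using this
      · exact testBit_encK_of_ge a₀ t ω i (by omega)

/-! ### Vanishing at the variable `2^k = δ` -/

/-- The marginal forms vanish at the variable `2^k = δ`. -/
theorem margMemK_D (x : ℕ) : c.margMem x (2 ^ k) = false := by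
  unfold Cert.margMem; rw [hm]; simp

/-- The threshold form vanishes at the variable `2^k = δ`. -/
theorem tMemK_D : c.tMem (2 ^ k) = false := by
  unfold Cert.tMem; rw [hm]; simp

include hfam in
/-- The case forms vanish at the variable `2^k = δ`. -/
theorem eMemK_D (x : ℕ) : c.eMem x (2 ^ k) = false := by
  unfold Cert.eMem; rw [hfam, hm]; simp

/-- A well-formed mask has no bit `2^k`. -/
theorem tb_D_of_maskOKK (A X mk : ℕ) (hmk : c.maskOK A X mk = true) : tb mk (2 ^ k) = false := by
  unfold Cert.maskOK at hmk
  simp only [Bool.and_eq_true, Nat.blt_eq, hm] at hmk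
  rw [tb_eq]
  exact Nat.testBit_lt_two_pow hmk.1

end Dictionary

end QCert
end HubOnly

end Summit.CriticalPhenomena.PercolationContinuityZ3.Theorems

end
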